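import Mathlib
import Summits.CriticalPhenomena.PercolationContinuityZ3.Theorems.PercNearOneGluingNoHeavyLowerTailOrderedDifferencesQuadraticTangent

/-!
# Tangential certificates for `(5 ± √21)/2` at the ramified primes `3` and `7`

Helper file for crux `stmt-CriticalPhenomena-4575` (`NoHeavyLowerTail`, route `PercNearOneGluingNoHeavy`), new-inequality factory
seat `prim-ineq-gen-3` (gen 30).  Everything here is PROVED; no definitions.  Two instances of
`linearIndependent_pencil_quad_of_tangent_certificate` (`…QuadraticTangent`): the unit class `t² = 5t − 1` (discriminant `21`) is
ramified at `3` (`(t − 1)²`, `θ = 1`, `π = 1 − t`, `N(π) = −3`) and at `7` (`(t + 1)²`, `θ = −1`, `π = 1 + t`, `N(π) = 7`); at either prime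
'no left Jordan chain of length two at `θ`' certifies (C0) at the class (memo `CONJECTURE-J.md` §2).
(prim-ineq-gen-3 gen 30, 2026-08-26.)
-/

namespace Summit.CriticalPhenomena.PercolationContinuityZ3.Theorems

namespace OrderedDifferences

open Finset
open scoped FinsetFamily

variable {α : Type*} [DecidableEq α]

/-- **`(5 ± √21)/2` at the ramified prime `3`** (`t² = 5t − 1 ≡ (t − 1)²` mod 3, `θ = 1`, `π = 1 − t`, `N(π) = −3`): no left Jordan chain
of length two at `θ = 1` over characteristic `3` ⟹ (C0) at the class `t² = 5t − 1`. -/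
theorem linearIndependent_pencil_sqrt21_of_tangent_three (𝒜 : Finset (Finset α))
    {F : Type*} [Field F] [CharP F 3]
    (hF : ∀ v₀ v₁ : ↥𝒜 → F,
      (∀ E ∈ 𝒜 \\ 𝒜, ∑ A : 𝒜, v₀ A *
        ((if E ⊆ (A : Finset α) then (1 : F) else 0) + ((1 : ℤ) : F) * (if Disjoint E (A : Finset α) then (1 : F) else 0)) = 0) →
      (∀ E ∈ 𝒜 \\ 𝒜, ∑ A : 𝒜, (v₁ A *
        ((if E ⊆ (A : Finset α) then (1 : F) else 0) + ((1 : ℤ) : F) * (if Disjoint E (A : Finset α) then (1 : F) else 0)) +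
          v₀ A * (if Disjoint E (A : Finset α) then (1 : F) else 0)) = 0) →
      v₀ = 0)
    {K : Type*} [Field K] [CharZero K] {t : K} (ht : t * t = ((5 : ℤ) : K) * t + ((-1 : ℤ) : K)) :
    LinearIndependent K (fun A : 𝒜 => fun E : (𝒜 \\ 𝒜 : Finset (Finset α)) =>
      (if (E : Finset α) ⊆ (A : Finset α) then (1 : K) else 0) +
        t * (if Disjoint (E : Finset α) (A : Finset α) then (1 : K) else 0)) := by
  refine linearIndependent_pencil_quad_of_tangent_certificate 𝒜 5 (-1) 1 1 (-1) (-3) 3 (by norm_num) (by norm_num) (by norm_num)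
    (by norm_num) (by norm_num) ?_ ?_ ?_ hF ht
  · intro a b h; omega
  · intro a b h; omega
  · intro n h
    have : (2 * n - 5) * (2 * n - 5) = 21 := by linear_combination 4 * h
    have hb : 2 * n - 5 ≤ 4 ∧ -4 ≤ 2 * n - 5 := by constructor <;> nlinarith
    have : n = 1 ∨ n = 2 ∨ n = 3 ∨ n = 4 := by omega
    rcases this with rfl | rfl | rfl | rfl <;> norm_num at h

/-- **`(5 ± √21)/2` at the ramified prime `7`** (`t² = 5t − 1 ≡ (t + 1)²` mod 7, `θ = −1`, `π = 1 + t`, `N(π) = 7`): no left Jordan chain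
of length two at `θ = −1` over characteristic `7` ⟹ (C0) at the class `t² = 5t − 1`. -/
theorem linearIndependent_pencil_sqrt21_of_tangent_seven (𝒜 : Finset (Finset α))
    {F : Type*} [Field F] [CharP F 7]
    (hF : ∀ v₀ v₁ : ↥𝒜 → F,
      (∀ E ∈ 𝒜 \\ 𝒜, ∑ A : 𝒜, v₀ A *
        ((if E ⊆ (A : Finset α) then (1 : F) else 0) + ((-1 : ℤ) : F) * (if Disjoint E (A : Finset α) then (1 : F) else 0)) = 0) →
      (∀ E ∈ 𝒜 \\ 𝒜, ∑ A : 𝒜, (v₁ A *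
        ((if E ⊆ (A : Finset α) then (1 : F) else 0) + ((-1 : ℤ) : F) * (if Disjoint E (A : Finset α) then (1 : F) else 0)) +
          v₀ A * (if Disjoint E (A : Finset α) then (1 : F) else 0)) = 0) →
      v₀ = 0)
    {K : Type*} [Field K] [CharZero K] {t : K} (ht : t * t = ((5 : ℤ) : K) * t + ((-1 : ℤ) : K)) :
    LinearIndependent K (fun A : 𝒜 => fun E : (𝒜 \\ 𝒜 : Finset (Finset α)) =>
      (if (E : Finset α) ⊆ (A : Finset α) then (1 : K) else 0) +
        t * (if Disjoint (E : Finset α) (A : Finset α) then (1 : K) else 0)) := by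
  refine linearIndependent_pencil_quad_of_tangent_certificate 𝒜 5 (-1) (-1) 1 1 7 7 (by norm_num) (by norm_num) (by norm_num)
    (by norm_num) (by norm_num) ?_ ?_ ?_ hF ht
  · intro a b h; omega
  · intro a b h; omega
  · intro n h
    have : (2 * n - 5) * (2 * n - 5) = 21 := by linear_combination 4 * h
    have hb : 2 * n - 5 ≤ 4 ∧ -4 ≤ 2 * n - 5 := by constructor <;> nlinarith
    have : n = 1 ∨ n = 2 ∨ n = 3 ∨ n = 4 := by omega
    rcases this with rfl | rfl | rfl | rfl <;> norm_num at h

end OrderedDifferences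

end Summit.CriticalPhenomena.PercolationContinuityZ3.Theorems
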